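import Summits.BirchSwinnertonDyer.BirchSwinnertonDyer.Theorems.GoldfeldAllTwistsTwoConverseTwinAdditiveSign
import Summits.BirchSwinnertonDyer.BirchSwinnertonDyer.Theorems.GoldfeldK12AdditiveTwoWildTwists
import Literature.NumberTheory.EllipticCurves.SelmerCorankIsogenyProofs
import Literature.NumberTheory.EllipticCurves.BSDSelmerPParityUnfoldingProofs
import HarnessLib

set_option linter.dupNamespace false -- namespace `…BirchSwinnertonDyer.BirchSwinnertonDyer…` is the cell's (D-0017 nested layout)
set_option autoImplicit false

/-!
# Route `GoldfeldAllTwistsTwoConverse`, crux K12₂″ `RankOneTwoConverseCMSevenAdditiveTwo` (item 20044):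
# the SIGN of the cell on the rank axis — K12₂″ lives on the NEGATIVE twists `49a1^{(d)}`, `d < 0`, `7 ∤ d`

Cell `bsd-goldfeld`, seat `bsd-goldfeld-s1p-c301` (prover, gen 3; neighbour item — this seat's item is twin″
19140), supporting item `stmt-BirchSwinnertonDyer-20044` (route decl
`Summit.BirchSwinnertonDyer.BirchSwinnertonDyer.Theses.GoldfeldAllTwistsTwoConverse.RankOneTwoConverseCMSevenAdditiveTwo`,
K12₂″: for every globally minimal `W/ℚ` with `j = −3375`, NOT good at `2`: `corank_{ℤ₂} Sel_{2^∞}(W) = 1 ⟹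
ord_{s=1} L(W, s) = 1`). OPEN; nothing asserted. Theorems only: no definition, no axiom, no `sorry`.

The rank-axis twin of `…TwinAdditiveSign` §5: by this seat's `rootNumber_quadraticTwist_cm7`
(`w(49a1^{(d)}) = sign d` for `7 ∤ d`) and the `2`-parity fact `p_parity W 2` (Dokchitser–Dokchitser 2010,
binder `hpar`: `(−1)^{corank} = w`), a model of a POSITIVE twist `49a1^{(d)}`, `d > 0`, `7 ∤ d`, has EVEN
`2^∞`-Selmer corank (`even_selmerCorank_of_smul_eq_quadraticTwist_cm7_of_pos`), so the hypothesis `corank = 1`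
of K12₂″ is never met there; and `49a1^{(7e)} ∼ 49a1^{(−e)}` (the `7`-isogeny, Selmer corank and analytic rank
being isogeny invariants) moves the twists divisible by `7` into the family prime to `7`. Hence
(`rankOneTwoConverseCMSevenAdditiveTwo_iff_negTwists`): granted Modularity (`hnf`), CLTZ Thm. 1.2 at `R = 1`
(`h12`, `w(X₀(49)) = +1`) and `2`-parity (`hpar`),

  K12₂″ ⟺ ∀ `d < 0` squarefree, `7 ∤ d`, `d ≢ 1 (mod 4)`, ∀ globally minimal `W′ ≅ 49a1^{(d)}`:
          `corank_{ℤ₂} Sel_{2^∞}(W′) = 1 ⟹ ord_{s=1} L(W′, s) = 1`,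

exactly the families of seat c301 gen 2's 2-isogeny descents (cell memo PRIME-TWIST-DESCENT.md), and the same
negative half on which twin″ lives (`bsdTwoCMSevenAdditiveRankOne_iff_negTwists`). On the positive half K12₂″
(and twin″) are VACUOUS by parity.

References: T. Dokchitser, V. Dokchitser, Ann. of Math. 172 (2010) Thm. 1.4, Cor. 4.20 [DokchitserDokchitserAnnals2010];
M. R. Murty, V. K. Murty (1997) Ch. 6 §1 [MurtyMurty1997]; J. Coates, Y. Li, Y. Tian, S. Zhai, PLMS 110 (2015) Thm. 1.2,
§1 [CoatesLiTianZhai2015]; A. Barrios et al. 2025 Thm. 5.1 [BarriosEtAl2025]; J. H. Silverman, *AEC* (2009) X.5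
Cor. 5.4 [SilvermanAEC2009].
-/

noncomputable section

open scoped Classical

open WeierstrassCurve Literature.NumberTheory.EllipticCurves Literature.NumberTheory.EllipticCurves.ModularForms
  Literature.NumberTheory.EllipticCurves.Rank1Residual

namespace Summit.BirchSwinnertonDyer.BirchSwinnertonDyer.Theorems.GoldfeldGoodTwists

/-! ## §1 Parity of the `2^∞`-Selmer corank on the positive and negative twists -/

/-- **Positive twists have EVEN `2^∞`-Selmer corank.** If `C • W = 49a1^{(d)}` with `d > 0` squarefree,
`7 ∤ d`, then `corank_{ℤ₂} Sel_{2^∞}(W/ℚ)` is even: `w(W) = sign d = +1` (`rootNumber_of_smul_eq_quadraticTwist_cm7`)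
and `(−1)^{corank} = w(W)` (`2`-parity, binder `hpar`). In particular the corank is not `1`.
[cite: DokchitserDokchitserAnnals2010, Thm. 1.4 and Cor. 4.20] [cite: MurtyMurty1997, Ch. 6 §1] -/
theorem even_selmerCorank_of_smul_eq_quadraticTwist_cm7_of_pos (hnf : exists_isNewformOf)
    (h12 : CoatesLiTianZhai2015.thm12_fullBSD_twist) (hpar : ∀ (V : WeierstrassCurve ℚ) [V.IsElliptic], p_parity V 2)
    {d : ℤ} (hsq : Squarefree d) (h7 : ¬ (7 : ℤ) ∣ d) (hd : 0 < d) (W : WeierstrassCurve ℚ) [W.IsElliptic]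
    (C : VariableChange ℚ) (hC : C • W = cm7.quadraticTwist (d : ℚ)) : Even (W.selmerCorank 2) := by
  haveI : Fact (Nat.Prime 2) := ⟨Nat.prime_two⟩
  have hw : W.rootNumber = 1 := by
    rw [rootNumber_of_smul_eq_quadraticTwist_cm7 hnf h12 hsq h7 W C hC, Int.sign_eq_one_of_pos hd]
  rcases (W.selmerCorank 2).even_or_odd with he | ho
  · exact he
  · have h := (p_parity_iff_rootNumber_eq_neg_one_of_odd W 2 ho).mp (hpar W)
    rw [hw] at h
    exact absurd h (by norm_num)

/-- `corank_{ℤ₂} Sel_{2^∞}(W) ≠ 1` for every model `W` of a positive twist `49a1^{(d)}`, `d > 0` squarefree, `7 ∤ d`.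
[cite: DokchitserDokchitserAnnals2010, Thm. 1.4 and Cor. 4.20] -/
theorem selmerCorank_ne_one_of_smul_eq_quadraticTwist_cm7_of_pos (hnf : exists_isNewformOf)
    (h12 : CoatesLiTianZhai2015.thm12_fullBSD_twist) (hpar : ∀ (V : WeierstrassCurve ℚ) [V.IsElliptic], p_parity V 2)
    {d : ℤ} (hsq : Squarefree d) (h7 : ¬ (7 : ℤ) ∣ d) (hd : 0 < d) (W : WeierstrassCurve ℚ) [W.IsElliptic]
    (C : VariableChange ℚ) (hC : C • W = cm7.quadraticTwist (d : ℚ)) : W.selmerCorank 2 ≠ 1 := fun h1 ↦ by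
  have h := even_selmerCorank_of_smul_eq_quadraticTwist_cm7_of_pos hnf h12 hpar hsq h7 hd W C hC
  rw [h1] at h
  exact absurd h (by decide)

/-- **Negative twists have ODD `2^∞`-Selmer corank** (`w(W) = −1` and `2`-parity). [cite: DokchitserDokchitserAnnals2010, Thm. 1.4 and Cor. 4.20] -/
theorem odd_selmerCorank_of_smul_eq_quadraticTwist_cm7_of_neg (hnf : exists_isNewformOf)
    (h12 : CoatesLiTianZhai2015.thm12_fullBSD_twist) (hpar : ∀ (V : WeierstrassCurve ℚ) [V.IsElliptic], p_parity V 2)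
    {d : ℤ} (hsq : Squarefree d) (h7 : ¬ (7 : ℤ) ∣ d) (hd : d < 0) (W : WeierstrassCurve ℚ) [W.IsElliptic]
    (C : VariableChange ℚ) (hC : C • W = cm7.quadraticTwist (d : ℚ)) : Odd (W.selmerCorank 2) := by
  haveI : Fact (Nat.Prime 2) := ⟨Nat.prime_two⟩
  have hw : W.rootNumber = -1 := by
    rw [rootNumber_of_smul_eq_quadraticTwist_cm7 hnf h12 hsq h7 W C hC, Int.sign_eq_neg_one_of_neg hd]
  rcases (W.selmerCorank 2).even_or_odd with he | ho
  · have h := (p_parity_iff_rootNumber_eq_one_of_even W 2 he).mp (hpar W)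
    rw [hw] at h
    exact absurd h (by norm_num)
  · exact ho

/-! ## §2 K12₂″ ⟺ its restriction to the negative twists prime to `7` -/

/-- **K12₂″ ⟹ its negative-twist form (unconditional):** a globally minimal `W′ ≅ 49a1^{(d)}` with `d ≠ 0`,
`d ≢ 1 (mod 4)` has `j = −3375` and is NOT good at `2` (Barrios et al. rows `I₀`), so the route decl applies.
[cite: BarriosEtAl2025, Thm. 5.1 (rows R = I₀)] [cite: SilvermanAEC2009, X.5 Cor. 5.4] -/
theorem negTwists_of_rankOneTwoConverseCMSevenAdditiveTwo
    (h : Summit.BirchSwinnertonDyer.BirchSwinnertonDyer.Theses.GoldfeldAllTwistsTwoConverse.RankOneTwoConverseCMSevenAdditiveTwo) :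
    ∀ (d : ℤ), d < 0 → Squarefree d → ¬ (7 : ℤ) ∣ d → d % 4 ≠ 1 →
      ∀ (W' : WeierstrassCurve ℚ) [W'.IsElliptic] [W'.IsGloballyMinimal] (C : VariableChange ℚ),
        C • W' = cm7.quadraticTwist (d : ℚ) → W'.selmerCorank 2 = 1 → W'.analyticRank = 1 := by
  intro d _ hsq _ hd4 W' _ _ C hC hsel
  haveI : Fact (Nat.Prime 2) := ⟨Nat.prime_two⟩
  have hsq4 : ¬ (4 : ℤ) ∣ d := fun h4 ↦ by
    have : (2 * 2 : ℤ) ∣ d := by simpa using h4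
    exact absurd (Int.isUnit_iff.mp (hsq 2 this)) (by decide)
  have hg : ¬ W'.HasGoodReductionAtPrime 2 :=
    not_hasGoodReductionAtPrime_two_of_smul_eq_quadraticTwist cm7 W' hasGoodReductionAtPrime_cm7_two
      (d := d) (by omega) hC
  exact h W' (j_eq_neg3375_of_smul_eq_quadraticTwist_cm7 W' hsq.ne_zero hC) hg hsel

/-- **K12₂″ from its negative-twist form**, granted Modularity (`hnf`), CLTZ Thm. 1.2 at `R = 1` (`h12`) and
`2`-parity (`hpar`). Given `W` globally minimal with `j = −3375`, bad at `2`, of corank `1`: `W ≅ 49a1^{(d)}` with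
`d` squarefree, `d ≢ 1 (mod 4)` (seat c301 file 1); if `7 ∤ d` the corank `1` forces `d < 0` (§1); if `d = 7e` then
`W ∼ W″` for a globally minimal `W″ ≅ 49a1^{(−e)}` (`isIsogenous_quadraticTwist_cm7_neg_seven_mul`), Selmer corank
and analytic rank are isogeny invariants (`IsIsogenous.selmerCorank_eq`, `analyticRank_eq_of_isIsogenous'`), `7 ∤ e`,
`−e ≡ 7e (mod 4)`, and again `−e < 0` by §1. [cite: DokchitserDokchitserAnnals2010, Thm. 1.4 and Cor. 4.20]
[cite: CoatesLiTianZhai2015, §1 (p. 359: A^{(d)} ∼ A^{(−7d)})] [cite: MurtyMurty1997, Ch. 6 §1] -/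
theorem rankOneTwoConverseCMSevenAdditiveTwo_of_negTwists (hnf : exists_isNewformOf)
    (h12 : CoatesLiTianZhai2015.thm12_fullBSD_twist) (hpar : ∀ (V : WeierstrassCurve ℚ) [V.IsElliptic], p_parity V 2)
    (h : ∀ (d : ℤ), d < 0 → Squarefree d → ¬ (7 : ℤ) ∣ d → d % 4 ≠ 1 →
      ∀ (W' : WeierstrassCurve ℚ) [W'.IsElliptic] [W'.IsGloballyMinimal] (C : VariableChange ℚ),
        C • W' = cm7.quadraticTwist (d : ℚ) → W'.selmerCorank 2 = 1 → W'.analyticRank = 1) :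
    Summit.BirchSwinnertonDyer.BirchSwinnertonDyer.Theses.GoldfeldAllTwistsTwoConverse.RankOneTwoConverseCMSevenAdditiveTwo := by
  intro W _ _ hj hg hsel
  haveI : Fact (Nat.Prime 2) := ⟨Nat.prime_two⟩
  obtain ⟨d, hd0, hsq, hd4, C, hC⟩ := exists_squarefree_twist_of_j_neg3375_of_not_good_two W hj hg
  by_cases h7 : (7 : ℤ) ∣ d
  · -- `d = 7e`: pass to the isogenous twist by `−e`
    obtain ⟨e, rfl⟩ := h7
    have he0 : -e ≠ 0 := by intro h0; apply hd0; omega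
    have heQ : ((-e : ℤ) : ℚ) ≠ 0 := Int.cast_ne_zero.mpr he0
    have hsqe : Squarefree (-e) := hsq.squarefree_of_dvd ⟨-7, by ring⟩
    have h7e : ¬ (7 : ℤ) ∣ -e := by
      rintro ⟨f, hf⟩
      have : (7 * 7 : ℤ) ∣ 7 * e := ⟨-f, by linarith⟩
      exact absurd (Int.isUnit_iff.mp (hsq 7 this)) (by decide)
    have he4 : (-e) % 4 ≠ 1 := by omega
    obtain ⟨W'', hE'', hmin'', C'', hC''⟩ := exists_isGloballyMinimal_smul_eq_quadraticTwist cm7 heQ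
    haveI := cm7.isElliptic_quadraticTwist (Int.cast_ne_zero.mpr hd0 : ((7 * e : ℤ) : ℚ) ≠ 0)
    haveI := cm7.isElliptic_quadraticTwist heQ
    have hiso : IsIsogenous W W'' := by
      have h1 : IsIsogenous W (cm7.quadraticTwist ((7 * e : ℤ) : ℚ)) := by
        rw [← hC]; exact (isIsogenous_self W).smul_right C
      have h2 : IsIsogenous (cm7.quadraticTwist ((7 * e : ℤ) : ℚ)) (cm7.quadraticTwist ((-e : ℤ) : ℚ)) := by
        have h := isIsogenous_quadraticTwist_cm7_neg_seven_mul he0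
        rw [show (-7 * -e : ℤ) = 7 * e by ring] at h
        exact h.symm_of_isElliptic
      have h3 : IsIsogenous (cm7.quadraticTwist ((-e : ℤ) : ℚ)) W'' := by
        have h := (isIsogenous_self (C'' • W'')).smul_right C''⁻¹
        rw [inv_smul_smul] at h
        rwa [hC''] at h
      exact (h1.trans' h2).trans' h3
    have hsel'' : W''.selmerCorank 2 = 1 := by rw [← hiso.selmerCorank_eq 2]; exact hsel
    have hneg : -e < 0 := by
      by_contra hle
      have hpos : 0 < -e := lt_of_le_of_ne (not_lt.mp hle) (Ne.symm he0)
      exact selmerCorank_ne_one_of_smul_eq_quadraticTwist_cm7_of_pos hnf h12 hpar hsqe h7e hpos W'' C'' hC'' hsel''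
    rw [analyticRank_eq_of_isIsogenous' hiso]
    exact h (-e) hneg hsqe h7e he4 W'' C'' hC'' hsel''
  · have hneg : d < 0 := by
      by_contra hle
      have hpos : 0 < d := lt_of_le_of_ne (not_lt.mp hle) (Ne.symm hd0)
      exact selmerCorank_ne_one_of_smul_eq_quadraticTwist_cm7_of_pos hnf h12 hpar hsq h7 hpos W C hC hsel
    exact h d hneg hsq h7 hd4 W C hC hsel

/-- **K12₂″ ⟺ the rank-one `2^∞`-Selmer converse on the NEGATIVE additive twists prime to `7`**, granted
Modularity, CLTZ Thm. 1.2 at `R = 1` and the `2`-parity theorem (for ⟸ only). With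
`bsdTwoCMSevenAdditiveRankOne_iff_negTwists` (twin″): both open cruxes of S1⁺ live on the same negative half of the
additive cell — the minimal models of `49a1^{(−m)}`, `49a1^{(−2m)}` (`m ≡ 1 (mod 4)`), `49a1^{(2m)}`
(`m ≡ 3 (mod 4)`), `m > 0` squarefree prime to `7`. [cite: DokchitserDokchitserAnnals2010, Thm. 1.4 and Cor. 4.20]
[cite: MurtyMurty1997, Ch. 6 §1] [cite: BurungaleCastellaSkinnerTian2022, Rem. D] -/
theorem rankOneTwoConverseCMSevenAdditiveTwo_iff_negTwists (hnf : exists_isNewformOf)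
    (h12 : CoatesLiTianZhai2015.thm12_fullBSD_twist) (hpar : ∀ (V : WeierstrassCurve ℚ) [V.IsElliptic], p_parity V 2) :
    Summit.BirchSwinnertonDyer.BirchSwinnertonDyer.Theses.GoldfeldAllTwistsTwoConverse.RankOneTwoConverseCMSevenAdditiveTwo ↔
      ∀ (d : ℤ), d < 0 → Squarefree d → ¬ (7 : ℤ) ∣ d → d % 4 ≠ 1 →
        ∀ (W' : WeierstrassCurve ℚ) [W'.IsElliptic] [W'.IsGloballyMinimal] (C : VariableChange ℚ),
          C • W' = cm7.quadraticTwist (d : ℚ) → W'.selmerCorank 2 = 1 → W'.analyticRank = 1 :=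
  ⟨negTwists_of_rankOneTwoConverseCMSevenAdditiveTwo,
    rankOneTwoConverseCMSevenAdditiveTwo_of_negTwists hnf h12 hpar⟩

end Summit.BirchSwinnertonDyer.BirchSwinnertonDyer.Theorems.GoldfeldGoodTwists

end
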